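import Literature.MathematicalPhysics.QuantumLattice.FermionDKMSStates
import Literature.MathematicalPhysics.QuantumLattice.PairSourceWindowLocalHamiltonian
import Literature.MathematicalPhysics.QuantumLattice.PairSourcedTorusLimitResponse
import HarnessLib

/-!
# Thermal states of the PAIR-SOURCED `t–t'` Hubbard torus are equilibrium (dKMS) states of the sourced model, and their
# zero-source limits — Koma–Tasaki's infinitesimal-field states (1.8) at `T > 0` — are equilibrium states of the `t–t'`
# Hubbard model (stationarity + energy–entropy balance rows for EVERY local generator; limits along a pencil of interactions)

Topic `Literature/MathematicalPhysics/QuantumLattice` (namespace = path; family `hubbard`).  The `T > 0`, SOURCE-BREAKS-`U(1)`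
twin of `HubbardTTPrimeGrandCanonicalThermalStatesKMSRows` + `FermionDKMSStates` §4 (there: the gauge-SYMMETRIC grand-canonical
Gibbs states of `K_L = H_L − μN − hM`), for the PAIR-SOURCED tori of the cuprate cell

  `A_L(h) = dWaveSourceTorusTT' L t' U μ h = H_L(1,t',U) − μN − h(Δ_d + Δ_d†)`   (Koma–Tasaki's symmetry-breaking field,
  J. Stat. Phys. 76 (1994) §1, §3.4; the thermal object = the eigen-mixtures `sourcedGibbs{Count,WeightTT',VectorTT'}` of
  `DWaveSourceThermalGibbsMixtureDefs` / `…TorusLimit`, whose torus limits `ω` carry the `T > 0` response floor of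
  `DWaveSourceThermalResponseFloor`),

and the infinite-volume reading of Koma–Tasaki 1993 §1 for lattice electrons (CMP 158, p. 193 (1.8)–(1.10); p. 211: «the
method allows one to apply the theorem to … the electron pair condensation problems in lattice electron systems»): the states
«obtained by applying an infinitesimally small symmetry breaking field», `lim_{h↓0} lim_{L↑∞} tr(· e^{−βA_L(h)})/tr e^{−βA_L(h)}`.

## Contents (everything PROVED; no definition, no named fact, zero compute)

* §1–§2 FINITE VOLUME (any real `β, t', U, μ, h`): the translations commute with `A_L(h)`; the linearised energy–entropy
  balance inequality `0 ≤ Σ_i p_{L,i} Re⟨U_vψ_{L,i}, (β·Bᴴ[A_L,B] − s·BᴴB + q·BBᴴ) U_vψ_{L,i}⟩` (`e^{s−1} ≤ q`) for EVERY torus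
  operator `B` and the stationarity of every translated eigen-component (`TorusGibbsEnergyEntropyBalance` on the trivial sector);
  the eigen-mixture IS the Gibbs state (`sum_sourcedGibbsWeightTT'_mul_expect_eq_gibbsState`); translation averages of the
  embedded rows through the tree's torus locality `[A_L, ΓÃ] = Γ[H^{src}_{Λ'}, Ã]` (`dWaveSourceTorusTT'_commutator_fermionEmbed`,
  `H^{src}_{Λ'} = pairSourceWindowHamiltonianTT' d Λ' t' U μ h =` the local Hamiltonian of the sourced interaction,
  `pairSourceWindowHamiltonianTT'_dWave_eq_localHamiltonian`); `Σ_i p_{L,i} avg_L(P₀^d)(ψ_{L,i}) = Σ_i p_{L,i}⟨ψ_{L,i}, Δ_dψ_{L,i}⟩/L²`.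
* §3 THE ROWS of every torus limit `ω` of these Gibbs states along `Ls → ∞`: stationarity `ω(H^{src}_{Λ'}ΓB − ΓB H^{src}_{Λ'}) = 0`
  and EEB `0 ≤ Re ω(β·Ãᴴ[H^{src}_{Λ'}, Ã] − s·ÃᴴÃ + q·ÃÃᴴ)` for EVERY local `A` (`Λ ⊆ Λ'`, `thicken Λ 1 ⊆ Λ'`); hence
  **`IsTorusLimitOfMixture.isDKMSState_of_sourcedGibbs`: `ω` is an Araki–Moriya dKMS state at `β` of the SOURCED interaction
  `hubbardTTPrimeSourcedInteraction 1 t' U μ d h`** (and such states exist, `exists_isDKMSState_hubbardTTPrimeSourcedInteraction`).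
* §4 LIMITS ALONG A PENCIL (model-free): `derivation_pencil` (`δ_{Ψ₀+sΨ₁} = δ_{Ψ₀} + sδ_{Ψ₁}`) and
  **`IsDKMSState.of_tendsto_pencil`** — weak⋆ limits of dKMS states of `Ψ₀ + s_kΨ₁` at `β_k` with `s_k → s`, `β_k → β` are dKMS
  states of `Ψ₀ + sΨ₁` at `β` (Bratteli–Robinson II Prop. 5.3.25 in the tree's lattice-local form); for the Hubbard model
  (`hubbardTTPrimeSourcedInteraction_zero_eq_gcInteractionTT'`): **zero-source limits of equilibrium states of the pair-sourced model
  are equilibrium (dKMS) states of the grand-canonical `t–t'` Hubbard interaction `gcInteractionTT' t t' U μ 0`**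
  (`IsDKMSState.gcInteractionTT'_of_tendsto_source`) — KT93's states (1.8) are genuine equilibrium states.
* §5 ZERO-TEMPERATURE LIMITS ALONG A PENCIL (Bratteli–Kishimoto–Robinson §I, joint form):
  `IsGroundState.of_isDKMSState_pencil_tendsto_atTop` — dKMS states of `Ψ₀ + s_kΨ₁` at `β_k → ∞`, `s_k → s`, converge (when they do)
  to infinite-volume GROUND states of `Ψ₀ + sΨ₁`; for the Hubbard model: `β_k → ∞`, `h_k → h` limits of sourced equilibrium states
  are ground states of the sourced interaction at `h` (`IsGroundState.hubbardTTPrimeSourced_of_isDKMSState_tendsto_atTop`), and for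
  `h_k → 0` of `gcInteractionTT' t t' U μ 0` (`IsGroundState.gcInteractionTT'_of_isDKMSState_tendsto_source_atTop`) — KT93's ground
  states «obtained by letting `β → ∞` after the infinite volume limit», along any joint schedule.

The SEQUEL `HubbardInfinitesimalPairFieldThermalStates.lean` names the classes «sourced thermal state at `(β, h)`» and «infinitesimal
pair-field thermal state» (KT93 (1.8)), proves their existence by weak-⋆ compactness, and draws the implication «certified thermal
`d`-wave pair LRO ⇒ `Re ω(P^d_x) ≥ σ/√2` in every such state ⇒ a circle of distinct equilibrium states (`U(1)` breaking at `T > 0`)»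
from KT93 Theorem 2.1 and `FermionDKMSStatesGaugeOrbit`; here every theorem carries the defining data
(`IsTorusLimitOfMixture sourcedGibbsCount (sourcedGibbsWeightTT' β …) (sourcedGibbsVectorTT' …) Ls`, `h_k`, `ω_k`) explicitly.

HONEST SCOPE / WHAT THIS IS NOT: nothing here asserts pair long-range order or superconductivity for the Hubbard model at any
`(t', U, μ, β)`; dKMS ⟺ KMS (Araki–Moriya Thm. 6.4) is cited, not formalised; no uniqueness / high-temperature statement; no number
of record.

## Mathlib / tree search

`lean search 'isDKMSState_of_sourcedGibbs|of_tendsto_pencil|derivation_pencil|sourcedGibbs.*eeb|pencil_tendsto_atTop'` (2026-08-29): nothing; the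
gauge-symmetric rows are `IsTorusLimitOfMixture.re_expect_eeb_nonneg_of_gcGibbs` / `….isDKMSState_of_gcGibbs`.
REUSED: `sum_canonicalWeight_mul_re_expect_eeb_mulVec_nonneg`, `star_mulVec_dotProduct_commutator_mulVec_mulVec_eq_zero`,
`fockTranslate_val_conjTranspose_mul_val_mul`, `fockTranslate_val_mul_val_conjTranspose_mul` (`TorusGibbsEnergyEntropyBalance`);
`fockTranslate_mul_dWaveSourceTorusTT'`, `dWaveSourceTorusTT'_isHermitian` (`DWaveSourceNNNHopping`); `dWaveSourceTorusTT'_commutator_fermionEmbed`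
(`DWaveSourceNNNHoppingWindowHamiltonian`); `pairSourceWindowHamiltonianTT'_dWave_eq_localHamiltonian` (`PairSourceWindowLocalHamiltonian`);
`sourcedGibbs{Energy,Vector}TT'_eq`, `star_sourcedGibbsVectorTT'_dotProduct_self`, `dWaveSourceTorusTT'_mulVec_sourcedGibbsVectorTT'`,
`sourcedGibbsWeightTT'_nonneg`, `sum_sourcedGibbsWeightTT'`, `canonicalWeight_comp_equiv'` (`DWaveSourceThermalGibbsTorusLimit`);
`sum_canonicalWeight_mul_expect_sectorEigenvector_eq_gibbsState`, `gibbsState_submatrix_equiv`, `gibbsState_congr_inst`;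
`IsDKMSState.of_rows/of_tangent/tangent_le/re_expect_conjTranspose_mul_derivation`, `im_expect_conjTranspose_mul_commutator_eq_zero_of_stationary`
(`FermionDKMSStates`; §5 follows the proof of `IsGroundState.of_isDKMSState_tendsto_atTop` there); `torusAvgExpect_localPairAt_zero` (`PairSourcedTorusLimitResponse`); `IsTorusLimitOfMixture.isTranslationInvariant`,
`InfVolFermionState.exists_isTorusLimitOfMixture_subseq` (`TorusLimitOfMixtures{,Compactness}`); `FermionInteraction.ext`, `linearFamily_apply`,
`pencil_apply`, `localHamiltonian_pencil`, `hubbardTTPrimeSourcedInteraction_apply`, `hubbardTTPrimeMuInteraction_apply`.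

## References

* [KomaTasaki1993] T. Koma, H. Tasaki, *Symmetry breaking in Heisenberg antiferromagnets*, Commun. Math. Phys. 158 (1993)
  191–214: §1 p. 193 (1.8)–(1.10) (infinitesimal-field states, `m_s ≥ √3σ`); §2 (2.11), Theorem 2.1 (2.13), Corollary 2.2 (2.18),
  Remark after Theorem 6.1 (`U(1)`: `√2`); §7 p. 211 (electron pair condensation).
* [KomaTasaki1994] T. Koma, H. Tasaki, *Symmetry breaking and finite-size effects in quantum many-body systems*, J. Stat. Phys.
  76 (1994) 745–803: §1 (the sourced Hamiltonian `H − hO`), §3.4 (superconductivity in lattice electron systems: `o_x`, `U(1)`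
  generated by `(N_e − N)/2`), Cor. 2.9.
* [ArakiMoriya2003] H. Araki, H. Moriya, Rev. Math. Phys. 15 (2003) 93–198: Def. 6.3 (dKMS), Thm. 6.4 (dKMS ⟺ KMS), Thm. 5.13.
* [BratteliRobinsonII1997] O. Bratteli, D. W. Robinson, *Operator Algebras and Quantum Statistical Mechanics 2*, 2nd ed. (1997):
  Prop. 5.3.25 (limits of KMS states under convergent perturbations), Thm. 5.3.30 (KMS states: convex, weak⋆-closed), Prop. 5.3.33
  (symmetry and uniqueness), Thm. 5.3.15 (EEB ⟺ KMS), Thm. 6.2.4, §5.2.2.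
* [BratteliRobinsonI1987] O. Bratteli, D. W. Robinson, *Operator Algebras and Quantum Statistical Mechanics 1*, 2nd ed. (1987),
  §4.3.1 (group averages, limit states), Thm. 2.3.15 (weak-⋆ compactness).
* [FawziFawziScalet2024] H. Fawzi, O. Fawzi, S. O. Scalet, Nat. Commun. 15 (2024) 7394 = arXiv:2311.18706, Thm. 3.1
  (KMS ⟺ stationarity + EEB).
* [Israel1979] R. B. Israel, *Convexity in the Theory of Lattice Gases* (1979), Lemma II.3.1, §I.3 eq. (26).
-/

noncomputable section

namespace Literature.MathematicalPhysics.QuantumLattice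

open Matrix Finset HubbardWave0 Literature.Probability.LatticeModels ThermodynamicLimit
open _root_.Filter
open scoped _root_.Topology ComplexOrder BigOperators Matrix.Norms.L2Operator

/-! ### §1 Finite volume: covariance, energy–entropy balance and stationarity of the sourced Gibbs mixture -/

section FiniteVolume

variable (L : ℕ) [NeZero L] (β tp U μ h : ℝ)

/-- **The translations commute with the pair-sourced torus Hamiltonian** `A_L = H_L(1,t',U) − μN − h(Δ_d + Δ_d†)`.
[cite: BratteliRobinsonII1997, §5.2.2, Thm. 5.2.5] -/
theorem fockTranslate_commute_dWaveSourceTorusTT' (v : TorusSite 2 L) :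
    Commute (fockTranslate v).val (dWaveSourceTorusTT' L tp U μ h) :=
  fockTranslate_mul_dWaveSourceTorusTT' L v tp U μ h

/-- **The linearised EEB inequality for the translated Gibbs mixtures of the pair-sourced torus, EVERY torus operator `B`**
(the mixture lives on the whole Fock space; no conservation law is used — the source breaks `U(1)`): for a translation `v`
and all real `s, q` with `e^{s−1} ≤ q`,
`0 ≤ Σ_i p_{L,i} Re⟨U_vψ_{L,i}, (β·Bᴴ(A_L B − B A_L) − s·BᴴB + q·BBᴴ) U_vψ_{L,i}⟩`.
[cite: FawziFawziScalet2024, Thm. 3.1] [cite: ArakiMoriya2003, Def. 6.3] -/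
theorem sum_sourcedGibbsWeightTT'_mul_re_expect_eeb_fockTranslate_nonneg (v : TorusSite 2 L)
    (B : Matrix (Finset (Orb (FermionTorus 2 L))) (Finset (Orb (FermionTorus 2 L))) ℂ) {s q : ℝ}
    (hq : Real.exp (s - 1) ≤ q) :
    0 ≤ ∑ i, sourcedGibbsWeightTT' β tp U μ h L i *
      (star ((fockTranslate v).val *ᵥ sourcedGibbsVectorTT' tp U μ h L i) ⬝ᵥ
        ((((β : ℝ) : ℂ) • (Bᴴ * (dWaveSourceTorusTT' L tp U μ h * B - B * dWaveSourceTorusTT' L tp U μ h)) -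
            ((s : ℝ) : ℂ) • (Bᴴ * B) + ((q : ℝ) : ℂ) • (B * Bᴴ)) *ᵥ
          ((fockTranslate v).val *ᵥ sourcedGibbsVectorTT' tp U μ h L i))).re := by
  set K := dWaveSourceTorusTT' L tp U μ h with hKdef
  have hK : K.IsHermitian := dWaveSourceTorusTT'_isHermitian L tp U μ h
  have hvac : ∀ (X : Matrix (Finset (Orb (FermionTorus 2 L))) (Finset (Orb (FermionTorus 2 L))) ℂ)
      (i j : Finset (Orb (FermionTorus 2 L))), ¬ (fun _ => True) i → (fun _ => True) j → X i j = 0 :=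
    fun _ _ _ hi _ => (hi trivial).elim
  have key := sum_canonicalWeight_mul_re_expect_eeb_mulVec_nonneg (fun _ => True) hK (hvac K)
    (fockTranslate_val_conjTranspose_mul_val_mul L v) (fockTranslate_val_mul_val_conjTranspose_mul L v)
    (fockTranslate_commute_dWaveSourceTorusTT' L tp U μ h v) (hvac _) (hvac _) (hvac B) (hvac Bᴴ) β hq
  set e := sourcedGibbsIndex L with he
  refine key.trans_eq ?_
  rw [← Equiv.sum_comp e]
  refine Finset.sum_congr rfl fun i _ => ?_
  rw [sourcedGibbsWeightTT', show sourcedGibbsEnergyTT' tp U μ h L = sectorEigenvalue (fun _ => True) K hK ∘ e from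
    funext fun i => sourcedGibbsEnergyTT'_eq tp U μ h L i, canonicalWeight_comp_equiv', sourcedGibbsVectorTT'_eq]

/-- **Stationarity of the translated Gibbs components of the pair-sourced torus**: `U_vψ_{L,i}` is an eigenvector of
`A_L`, so `⟨U_vψ_{L,i}, (A_L X − X A_L) U_vψ_{L,i}⟩ = 0` for every `X`. [cite: FawziFawziScalet2024, Thm. 3.1] -/
theorem star_fockTranslate_mulVec_sourcedGibbsVectorTT'_dotProduct_commutator_mulVec_eq_zero (v : TorusSite 2 L)
    (i : Fin (sourcedGibbsCount L)) (X : Matrix (Finset (Orb (FermionTorus 2 L))) (Finset (Orb (FermionTorus 2 L))) ℂ) :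
    star ((fockTranslate v).val *ᵥ sourcedGibbsVectorTT' tp U μ h L i) ⬝ᵥ
      ((dWaveSourceTorusTT' L tp U μ h * X - X * dWaveSourceTorusTT' L tp U μ h) *ᵥ
        ((fockTranslate v).val *ᵥ sourcedGibbsVectorTT' tp U μ h L i)) = 0 :=
  star_mulVec_dotProduct_commutator_mulVec_mulVec_eq_zero (dWaveSourceTorusTT'_isHermitian L tp U μ h)
    (fockTranslate_commute_dWaveSourceTorusTT' L tp U μ h v)
    (dWaveSourceTorusTT'_mulVec_sourcedGibbsVectorTT' tp U μ h L i) X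

/-- **The eigen-mixture IS the Gibbs state of the pair-sourced torus, on every observable**:
`Σ_i p_{L,i}(β) ⟨ψ_{L,i}, B ψ_{L,i}⟩ = tr(e^{−βA_L} B)/tr e^{−βA_L} = ⟨B⟩_{β, A_L}`. [cite: Israel1979, §I.3 eq. (26)] -/
theorem sum_sourcedGibbsWeightTT'_mul_expect_eq_gibbsState
    (B : Matrix (Finset (Orb (FermionTorus 2 L))) (Finset (Orb (FermionTorus 2 L))) ℂ) :
    ∑ i, (sourcedGibbsWeightTT' β tp U μ h L i : ℂ) * expect B (sourcedGibbsVectorTT' tp U μ h L i) =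
      gibbsState β (dWaveSourceTorusTT' L tp U μ h) B := by
  set K := dWaveSourceTorusTT' L tp U μ h with hKdef
  have hK : K.IsHermitian := dWaveSourceTorusTT'_isHermitian L tp U μ h
  set e := sourcedGibbsIndex L with he
  set E := sectorEigenvalue (fun _ => True) K hK with hE
  have hw : ∀ i, sourcedGibbsWeightTT' β tp U μ h L i = canonicalWeight β E (e i) := by
    intro i
    rw [sourcedGibbsWeightTT', show sourcedGibbsEnergyTT' tp U μ h L = E ∘ e from
      funext fun i => sourcedGibbsEnergyTT'_eq tp U μ h L i, canonicalWeight_comp_equiv']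
  have hv : ∀ i, sourcedGibbsVectorTT' tp U μ h L i = sectorEigenvector (fun _ => True) K hK (e i) := fun i =>
    sourcedGibbsVectorTT'_eq tp U μ h L i
  simp_rw [hw, hv]
  rw [Equiv.sum_comp e (fun a => (canonicalWeight β E a : ℂ) *
    expect B (sectorEigenvector (fun _ => True) K hK a))]
  have h := sum_canonicalWeight_mul_expect_sectorEigenvector_eq_gibbsState (fun _ => True) K hK β B
  rw [hE]
  refine h.trans ?_
  classical
  have h2 := gibbsState_submatrix_equiv β K B
    (Equiv.subtypeUnivEquiv (fun _ => trivial) : {s : Finset (Orb (FermionTorus 2 L)) // True} ≃ _)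
  have hcoe : (⇑(Equiv.subtypeUnivEquiv (fun _ => trivial) : {s : Finset (Orb (FermionTorus 2 L)) // True} ≃ _) :
      {s : Finset (Orb (FermionTorus 2 L)) // True} → Finset (Orb (FermionTorus 2 L))) = Subtype.val := rfl
  rw [hcoe] at h2
  convert h2 using 1
  exact gibbsState_congr_inst _ _ _ _ _ _ _

/-- Real-part form: `Σ_i p_{L,i}(β) Re⟨ψ_{L,i}, B ψ_{L,i}⟩ = Re ⟨B⟩_{β, A_L}`. [cite: Israel1979, §I.3 eq. (26)] -/
theorem sum_sourcedGibbsWeightTT'_mul_re_expect_eq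
    (B : Matrix (Finset (Orb (FermionTorus 2 L))) (Finset (Orb (FermionTorus 2 L))) ℂ) :
    ∑ i, sourcedGibbsWeightTT' β tp U μ h L i * (expect B (sourcedGibbsVectorTT' tp U μ h L i)).re =
      (gibbsState β (dWaveSourceTorusTT' L tp U μ h) B).re := by
  rw [← sum_sourcedGibbsWeightTT'_mul_expect_eq_gibbsState, Complex.re_sum]
  refine Finset.sum_congr rfl fun i _ => ?_
  rw [Complex.re_ofReal_mul]

end FiniteVolume

/-! ### §2 Translation averages of the embedded local rows -/

section TorusAverage

variable (L : ℕ) [NeZero L] (β tp U μ h : ℝ)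

/-- **The EEB row of ANY local generator, averaged over the torus translations, is nonnegative in the Gibbs mixture of the
pair-sourced torus.** For `Λ ⊆ Λ'` with `thicken Λ 1 ⊆ Λ'`, `x ↦ x mod L` injective on `thicken Λ' 1`, every `A ∈ 𝔄_Λ`,
`Ã = Γ_{Λ⊆Λ'}A`, `H_{Λ'} = pairSourceWindowHamiltonianTT' d Λ' t' U μ h` (`= H^{tt'}_{Λ'} − μN_{Λ'} − h(S_{Λ'} + S_{Λ'}ᴴ)`),
`e^{s−1} ≤ q`: `0 ≤ Re Σ_i p_{L,i} · torusAvgExpectAt L Λ' (β·Ãᴴ(H_{Λ'}Ã − ÃH_{Λ'}) − s·ÃᴴÃ + q·ÃÃᴴ) ψ_{L,i}`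
(torus locality `[A_L, ΓÃ] = Γ[H_{Λ'}, Ã]`: `dWaveSourceTorusTT'_commutator_fermionEmbed`). [cite: FawziFawziScalet2024, Thm. 3.1] -/
theorem re_sum_sourcedGibbsWeightTT'_mul_torusAvgExpectAt_eeb_nonneg {Λ Λ' : Finset (Site 2)} (hΛ : Λ ⊆ Λ')
    (h8 : thicken Λ 1 ⊆ Λ') (hInj : Set.InjOn (Torus.proj (d := 2) L) ↑(thicken Λ' 1)) (A : FermionOp Λ)
    {s q : ℝ} (hq : Real.exp (s - 1) ≤ q) :
    0 ≤ (∑ i, (sourcedGibbsWeightTT' β tp U μ h L i : ℂ) *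
      torusAvgExpectAt L Λ'
        (((β : ℝ) : ℂ) • ((fermionEmbed (PolySite.incl hΛ) A)ᴴ *
            (pairSourceWindowHamiltonianTT' dWaveFormFactor Λ' tp U μ h * fermionEmbed (PolySite.incl hΛ) A -
              fermionEmbed (PolySite.incl hΛ) A * pairSourceWindowHamiltonianTT' dWaveFormFactor Λ' tp U μ h)) -
          ((s : ℝ) : ℂ) • ((fermionEmbed (PolySite.incl hΛ) A)ᴴ * fermionEmbed (PolySite.incl hΛ) A) +
          ((q : ℝ) : ℂ) • (fermionEmbed (PolySite.incl hΛ) A * (fermionEmbed (PolySite.incl hΛ) A)ᴴ))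
        (sourcedGibbsVectorTT' tp U μ h L i)).re := by
  have h₁ : Set.InjOn (Torus.proj (d := 2) L) ↑Λ' := hInj.mono (by exact_mod_cast subset_thicken Λ' 1)
  set K := dWaveSourceTorusTT' L tp U μ h with hKdef
  set B := fermionEmbed (PolySite.toTorusEmb L h₁) (fermionEmbed (PolySite.incl hΛ) A) with hBdef
  -- pull the row back into the torus
  have hΓ : fermionEmbed (PolySite.toTorusEmb L h₁)
      (((β : ℝ) : ℂ) • ((fermionEmbed (PolySite.incl hΛ) A)ᴴ *
            (pairSourceWindowHamiltonianTT' dWaveFormFactor Λ' tp U μ h * fermionEmbed (PolySite.incl hΛ) A -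
              fermionEmbed (PolySite.incl hΛ) A * pairSourceWindowHamiltonianTT' dWaveFormFactor Λ' tp U μ h)) -
          ((s : ℝ) : ℂ) • ((fermionEmbed (PolySite.incl hΛ) A)ᴴ * fermionEmbed (PolySite.incl hΛ) A) +
          ((q : ℝ) : ℂ) • (fermionEmbed (PolySite.incl hΛ) A * (fermionEmbed (PolySite.incl hΛ) A)ᴴ)) =
      ((β : ℝ) : ℂ) • (Bᴴ * (K * B - B * K)) - ((s : ℝ) : ℂ) • (Bᴴ * B) + ((q : ℝ) : ℂ) • (B * Bᴴ) := by
    rw [fermionEmbed_add, fermionEmbed_sub, fermionEmbed_smul, fermionEmbed_smul, fermionEmbed_smul,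
      fermionEmbed_mul, fermionEmbed_mul, fermionEmbed_mul, fermionEmbed_conjTranspose,
      ← dWaveSourceTorusTT'_commutator_fermionEmbed L hΛ h8 hInj tp U μ h A]
  -- each translate is nonnegative
  have hv : ∀ v : TorusSite 2 L, 0 ≤ ∑ i, sourcedGibbsWeightTT' β tp U μ h L i *
      (expect (((β : ℝ) : ℂ) • (Bᴴ * (K * B - B * K)) - ((s : ℝ) : ℂ) • (Bᴴ * B) + ((q : ℝ) : ℂ) • (B * Bᴴ))
        ((fockTranslate v).val *ᵥ sourcedGibbsVectorTT' tp U μ h L i)).re := fun v =>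
    sum_sourcedGibbsWeightTT'_mul_re_expect_eeb_fockTranslate_nonneg L β tp U μ h v B hq
  have hcast : ((Fintype.card (TorusSite 2 L) : ℂ))⁻¹ = (((Fintype.card (TorusSite 2 L) : ℝ)⁻¹ : ℝ) : ℂ) := by
    push_cast; rfl
  simp_rw [torusAvgExpectAt_of_injOn L h₁, hΓ]
  rw [Complex.re_sum]
  simp_rw [hcast, ← mul_assoc, ← Complex.ofReal_mul, Complex.re_ofReal_mul, Complex.re_sum, Finset.mul_sum]
  rw [Finset.sum_comm]
  refine Finset.sum_nonneg fun v _ => ?_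
  have hfac : ∑ i, sourcedGibbsWeightTT' β tp U μ h L i * (Fintype.card (TorusSite 2 L) : ℝ)⁻¹ *
      (expect (((β : ℝ) : ℂ) • (Bᴴ * (K * B - B * K)) - ((s : ℝ) : ℂ) • (Bᴴ * B) + ((q : ℝ) : ℂ) • (B * Bᴴ))
        ((fockTranslate v).val *ᵥ sourcedGibbsVectorTT' tp U μ h L i)).re =
      (Fintype.card (TorusSite 2 L) : ℝ)⁻¹ * ∑ i, sourcedGibbsWeightTT' β tp U μ h L i *
      (expect (((β : ℝ) : ℂ) • (Bᴴ * (K * B - B * K)) - ((s : ℝ) : ℂ) • (Bᴴ * B) + ((q : ℝ) : ℂ) • (B * Bᴴ))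
        ((fockTranslate v).val *ᵥ sourcedGibbsVectorTT' tp U μ h L i)).re := by
    rw [Finset.mul_sum]
    exact Finset.sum_congr rfl fun i _ => by ring
  rw [hfac]
  exact mul_nonneg (inv_nonneg.2 (Nat.cast_nonneg _)) (hv v)

/-- **The stationarity row of a local observable vanishes in every translated Gibbs component of the pair-sourced torus**:
`torusAvgExpectAt L Λ' (H_{Λ'} ΓB − ΓB H_{Λ'}) ψ_{L,i} = 0`. [cite: FawziFawziScalet2024, Thm. 3.1] -/
theorem torusAvgExpectAt_commutator_pairSourceWindowHamiltonianTT'_sourcedGibbsVectorTT' {Λ Λ' : Finset (Site 2)}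
    (hΛ : Λ ⊆ Λ') (h8 : thicken Λ 1 ⊆ Λ') (hInj : Set.InjOn (Torus.proj (d := 2) L) ↑(thicken Λ' 1))
    (B : FermionOp Λ) (i : Fin (sourcedGibbsCount L)) :
    torusAvgExpectAt L Λ'
        (pairSourceWindowHamiltonianTT' dWaveFormFactor Λ' tp U μ h * fermionEmbed (PolySite.incl hΛ) B -
          fermionEmbed (PolySite.incl hΛ) B * pairSourceWindowHamiltonianTT' dWaveFormFactor Λ' tp U μ h)
        (sourcedGibbsVectorTT' tp U μ h L i) = 0 := by
  have h₁ : Set.InjOn (Torus.proj (d := 2) L) ↑Λ' := hInj.mono (by exact_mod_cast subset_thicken Λ' 1)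
  rw [torusAvgExpectAt_of_injOn L h₁, ← dWaveSourceTorusTT'_commutator_fermionEmbed L hΛ h8 hInj tp U μ h B,
    Finset.sum_eq_zero fun v _ => ?_, mul_zero]
  rw [expect]
  exact star_fockTranslate_mulVec_sourcedGibbsVectorTT'_dotProduct_commutator_mulVec_eq_zero L tp U μ h v i _

/-- **The translation-averaged local pair `P₀^d` in the Gibbs mixture of the pair-sourced torus is the pair field per
site**: `Σ_i p_{L,i} avg_L(P₀^d)(ψ_{L,i}) = (Σ_i p_{L,i} ⟨ψ_{L,i}, Δ_d ψ_{L,i}⟩) / L²` (`L ≥ 3`; `= ⟨Δ_d⟩_{β, A_L}/L²` by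
`sum_sourcedGibbsWeightTT'_mul_expect_eq_gibbsState`). [cite: BratteliRobinsonI1987, §4.3.1] -/
theorem sum_sourcedGibbsWeightTT'_mul_torusAvgExpect_localPairAt_zero (hL : 3 ≤ L) :
    ∑ i, (sourcedGibbsWeightTT' β tp U μ h L i : ℂ) *
        torusAvgExpect L (pairRegion (insert (0 : Site 2) unitSteps) 0)
          (localPairAt (insert (0 : Site 2) unitSteps) dWaveFormFactor 0) (sourcedGibbsVectorTT' tp U μ h L i) =
      (∑ i, (sourcedGibbsWeightTT' β tp U μ h L i : ℂ) *
        expect (pairField dWaveFormFactor L) (sourcedGibbsVectorTT' tp U μ h L i)) / ((L : ℂ) ^ 2) := by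
  simp_rw [torusAvgExpect_localPairAt_zero _ dWaveFormFactor hL, mul_div_assoc']
  rw [Finset.sum_div]

end TorusAverage

/-! ### §3 The rows of the thermal states of the pair-sourced torus; they are dKMS states of the SOURCED interaction -/

namespace InfVolFermionState

section Rows

variable {β : ℝ} (tp U μ h : ℝ) {ω : InfVolFermionState 2} {Ls : ℕ → ℕ}

/-- **Stationarity rows.** Let `ω` be a torus limit of the grand-canonical Gibbs states of the pair-sourced tori
`A_{Ls j} = dWaveSourceTorusTT' (Ls j) t' U μ h` along `Ls → ∞` (any `β`). Then for `Λ ⊆ Λ'` with `thicken Λ 1 ⊆ Λ'` and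
EVERY local `B ∈ 𝔄_Λ`: `ω_{Λ'}(H_{Λ'} ΓB − ΓB H_{Λ'}) = 0`, `H_{Λ'} = pairSourceWindowHamiltonianTT' d Λ' t' U μ h` — the local
Hamiltonian of the SOURCED interaction (`pairSourceWindowHamiltonianTT'_dWave_eq_localHamiltonian`).
[cite: FawziFawziScalet2024, Thm. 3.1] [cite: BratteliRobinsonII1997, Thm. 6.2.4] -/
theorem IsTorusLimitOfMixture.expect_commutator_pairSourceWindowHamiltonianTT'_eq_zero_of_sourcedGibbs
    (hω : ω.IsTorusLimitOfMixture sourcedGibbsCount (sourcedGibbsWeightTT' β tp U μ h)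
      (sourcedGibbsVectorTT' tp U μ h) Ls)
    (hLs : Tendsto Ls atTop atTop) {Λ Λ' : Finset (Site 2)} (hΛ : Λ ⊆ Λ') (h8 : thicken Λ 1 ⊆ Λ')
    (B : FermionOp Λ) :
    ω.expect Λ'
      (pairSourceWindowHamiltonianTT' dWaveFormFactor Λ' tp U μ h * fermionEmbed (PolySite.incl hΛ) B -
        fermionEmbed (PolySite.incl hΛ) B * pairSourceWindowHamiltonianTT' dWaveFormFactor Λ' tp U μ h) = 0 := by
  refine tendsto_nhds_unique (hω Λ' _) (tendsto_const_nhds.congr' ?_)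
  filter_upwards [eventually_injOn_proj_of_tendsto (thicken Λ' 1) hLs, hLs.eventually_ge_atTop 1]
    with j hInj hj
  haveI : NeZero (Ls j) := ⟨by omega⟩
  refine (Finset.sum_eq_zero fun i _ => ?_).symm
  rw [torusAvgExpect_eq, torusAvgExpectAt_commutator_pairSourceWindowHamiltonianTT'_sourcedGibbsVectorTT' (Ls j)
    tp U μ h hΛ h8 hInj B i, mul_zero]

/-- **Energy–entropy balance rows, for EVERY local generator** (charged or not — the source itself breaks `U(1)`). Let
`ω` be a torus limit of the grand-canonical Gibbs states of the pair-sourced tori at inverse temperature `β` along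
`Ls → ∞`. Then for `Λ ⊆ Λ'` with `thicken Λ 1 ⊆ Λ'`, every `A ∈ 𝔄_Λ` and all real `s, q` with `e^{s−1} ≤ q`:
`0 ≤ Re ω_{Λ'}(β·Ãᴴ(H_{Λ'}Ã − ÃH_{Λ'}) − s·ÃᴴÃ + q·ÃÃᴴ)`, `Ã = Γ_{Λ⊆Λ'}A`,
`H_{Λ'} = H^{tt'}_{Λ'} − μN_{Λ'} − h(S_{Λ'} + S_{Λ'}ᴴ)`. [cite: FawziFawziScalet2024, Thm. 3.1] [cite: ArakiMoriya2003, Def. 6.3] -/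
theorem IsTorusLimitOfMixture.re_expect_eeb_nonneg_of_sourcedGibbs
    (hω : ω.IsTorusLimitOfMixture sourcedGibbsCount (sourcedGibbsWeightTT' β tp U μ h)
      (sourcedGibbsVectorTT' tp U μ h) Ls)
    (hLs : Tendsto Ls atTop atTop) {Λ Λ' : Finset (Site 2)} (hΛ : Λ ⊆ Λ') (h8 : thicken Λ 1 ⊆ Λ')
    (A : FermionOp Λ) {s q : ℝ} (hq : Real.exp (s - 1) ≤ q) :
    0 ≤ (ω.expect Λ'
      (((β : ℝ) : ℂ) • ((fermionEmbed (PolySite.incl hΛ) A)ᴴ *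
          (pairSourceWindowHamiltonianTT' dWaveFormFactor Λ' tp U μ h * fermionEmbed (PolySite.incl hΛ) A -
            fermionEmbed (PolySite.incl hΛ) A * pairSourceWindowHamiltonianTT' dWaveFormFactor Λ' tp U μ h)) -
        ((s : ℝ) : ℂ) • ((fermionEmbed (PolySite.incl hΛ) A)ᴴ * fermionEmbed (PolySite.incl hΛ) A) +
        ((q : ℝ) : ℂ) • (fermionEmbed (PolySite.incl hΛ) A * (fermionEmbed (PolySite.incl hΛ) A)ᴴ))).re := by
  refine ge_of_tendsto ((Complex.continuous_re.tendsto _).comp (hω Λ' _)) ?_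
  filter_upwards [eventually_injOn_proj_of_tendsto (thicken Λ' 1) hLs, hLs.eventually_ge_atTop 1]
    with j hInj hj
  haveI : NeZero (Ls j) := ⟨by omega⟩
  rw [Function.comp_apply]
  simp_rw [torusAvgExpect_eq]
  exact re_sum_sourcedGibbsWeightTT'_mul_torusAvgExpectAt_eeb_nonneg (Ls j) β tp U μ h hΛ h8 hInj A hq

/-- **THERMAL STATES OF THE PAIR-SOURCED `t–t'` HUBBARD TORUS ARE EQUILIBRIUM (dKMS) STATES OF THE SOURCED MODEL.** Every
torus limit `ω` of the grand-canonical Gibbs states `e^{−βA_L}/tr e^{−βA_L}` of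
`A_L = H_L(1,t',U) − μN − h(Δ_d + Δ_d†)` along `Ls → ∞` is an Araki–Moriya dKMS state at `β` of the pair-sourced
interaction `hubbardTTPrimeSourcedInteraction 1 t' U μ d h = Φ(1,t',U) − μn − hP_d` (range `1`) — all real `β, t', U, μ, h`
(EEB rows above; `(C-1)` from the stationarity rows applied to `AᴴA`). These are the states whose pair amplitude the
`T > 0` response floor `DWaveSourceThermalResponseFloor` bounds. [cite: ArakiMoriya2003, Def 6.3, Thm. 6.4]
[cite: FawziFawziScalet2024, Thm. 3.1] [cite: KomaTasaki1993, §1 (1.8)] -/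
theorem IsTorusLimitOfMixture.isDKMSState_of_sourcedGibbs
    (hω : ω.IsTorusLimitOfMixture sourcedGibbsCount (sourcedGibbsWeightTT' β tp U μ h)
      (sourcedGibbsVectorTT' tp U μ h) Ls)
    (hLs : Tendsto Ls atTop atTop) :
    ω.IsDKMSState (hubbardTTPrimeSourcedInteraction 1 tp U μ dWaveFormFactor h) 1 β := by
  refine IsDKMSState.of_rows (fun Λ A => ?_) (fun Λ A s q hq => ?_)
  · rw [← pairSourceWindowHamiltonianTT'_dWave_eq_localHamiltonian]
    refine ω.im_expect_conjTranspose_mul_commutator_eq_zero_of_stationary ?_ _ ?_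
    · rw [pairSourceWindowHamiltonianTT'_dWave_eq_localHamiltonian]
      exact FermionInteraction.localHamiltonian_isHermitian (hubbardTTPrimeSourcedInteraction_isHermitian 1 tp U μ _ h) _
    have hs := hω.expect_commutator_pairSourceWindowHamiltonianTT'_eq_zero_of_sourcedGibbs tp U μ h hLs
      (subset_thicken Λ 1) subset_rfl (Aᴴ * A)
    rwa [fermionEmbed_mul, fermionEmbed_conjTranspose] at hs
  · rw [← pairSourceWindowHamiltonianTT'_dWave_eq_localHamiltonian]
    exact hω.re_expect_eeb_nonneg_of_sourcedGibbs tp U μ h hLs (subset_thicken Λ 1) subset_rfl A hq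

/-- Hence, for all real `β, t', U, μ, h`, **the pair-sourced `t–t'` Hubbard interaction has a translation-invariant
equilibrium (dKMS) state at `β`** (a torus limit of sourced Gibbs states, by weak-⋆ compactness).
[cite: ArakiMoriya2003, Def 6.3] [cite: BratteliRobinsonI1987, Thm. 2.3.15] -/
theorem exists_isDKMSState_hubbardTTPrimeSourcedInteraction (β : ℝ) :
    ∃ ω : InfVolFermionState 2, ω.IsDKMSState (hubbardTTPrimeSourcedInteraction 1 tp U μ dWaveFormFactor h) 1 β ∧
      ω.IsTranslationInvariant := by
  obtain ⟨φ, hφ, ω, hω⟩ := InfVolFermionState.exists_isTorusLimitOfMixture_subseq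
    (sourcedGibbsWeightTT' β tp U μ h) (sourcedGibbsVectorTT' tp U μ h) (Ls := fun j => j + 1)
    (tendsto_add_atTop_nat 1) (fun _ i => sourcedGibbsWeightTT'_nonneg tp U μ h β _ i)
    (fun _ => sum_sourcedGibbsWeightTT' tp U μ h β _) (fun j i => star_sourcedGibbsVectorTT'_dotProduct_self tp U μ h _ i)
  exact ⟨ω, hω.isDKMSState_of_sourcedGibbs tp U μ h ((tendsto_add_atTop_nat 1).comp hφ.tendsto_atTop),
    hω.isTranslationInvariant⟩

end Rows

end InfVolFermionState

/-! ### §4 Limits along a pencil of interactions: zero-source limits of sourced equilibrium states are equilibrium states -/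

namespace FermionInteraction

variable {d : ℕ}

/-- **The derivation is affine along a pencil**: `δ_{Ψ₀ + sΨ₁} A = δ_{Ψ₀} A + s·δ_{Ψ₁} A` (`H_{Λ_R}` is affine in `s`).
[cite: KomaTasaki1994, §1] [cite: BratteliRobinsonII1997, Thm. 6.2.4] -/
theorem derivation_pencil (Ψ₀ Ψ₁ : FermionInteraction d) (s R : ℝ) (Λ : Finset (Site d)) (A : FermionOp Λ) :
    (pencil Ψ₀ Ψ₁ s).derivation R Λ A = Ψ₀.derivation R Λ A + (s : ℂ) • Ψ₁.derivation R Λ A := by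
  rw [derivation, derivation, derivation, localHamiltonian_pencil, Matrix.add_mul, Matrix.mul_add, Matrix.smul_mul,
    Matrix.mul_smul]
  module

end FermionInteraction

namespace InfVolFermionState

variable {d : ℕ}

/-- **Weak⋆ limits of dKMS states ALONG A PENCIL OF INTERACTIONS are dKMS states**: if `ω_k` is a dKMS state of
`Ψ₀ + s_kΨ₁` at `β_k` (range parameter `R`), `s_k → s`, `β_k → β` and `ω_k → ω` on every local algebra, then `ω` is a dKMS
state of `Ψ₀ + sΨ₁` at `β` — the rows are jointly continuous in `(ω, s, β)` because `ω_k(Ãᴴ δ_{s_k}A) = ω_k(Ãᴴ δ₀A) + s_k ω_k(Ãᴴ δ₁A)`.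
The case `Ψ₁ = ` a symmetry-breaking source, `s_k → 0`: limits of equilibrium states of the sourced models are equilibrium
states of the unsourced model (Bratteli–Robinson II Prop. 5.3.25 for perturbed dynamics; Koma–Tasaki's states (1.8)).
[cite: BratteliRobinsonII1997, Prop. 5.3.25 and Thm. 5.3.30] [cite: KomaTasaki1993, §1 (1.8)] [cite: ArakiMoriya2003, Def 6.3] -/
theorem IsDKMSState.of_tendsto_pencil {Ψ₀ Ψ₁ : FermionInteraction d} {R : ℝ} {ωk : ℕ → InfVolFermionState d}
    {sk βk : ℕ → ℝ} {s β : ℝ} {ω : InfVolFermionState d}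
    (hk : ∀ k, (ωk k).IsDKMSState (FermionInteraction.pencil Ψ₀ Ψ₁ (sk k)) R (βk k))
    (hs : Tendsto sk atTop (𝓝 s)) (hβ : Tendsto βk atTop (𝓝 β))
    (hlim : ∀ (Λ : Finset (Site d)) (A : FermionOp Λ), Tendsto (fun k => (ωk k).expect Λ A) atTop (𝓝 (ω.expect Λ A))) :
    ω.IsDKMSState (FermionInteraction.pencil Ψ₀ Ψ₁ s) R β := by
  have hconv : ∀ (Λ : Finset (Site d)) (A : FermionOp Λ),
      Tendsto (fun k => (ωk k).expect (thicken Λ R)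
        ((fermionEmbed (PolySite.incl (subset_thicken Λ R)) A)ᴴ *
          (FermionInteraction.pencil Ψ₀ Ψ₁ (sk k)).derivation R Λ A))
        atTop (𝓝 (ω.expect (thicken Λ R)
          ((fermionEmbed (PolySite.incl (subset_thicken Λ R)) A)ᴴ *
            (FermionInteraction.pencil Ψ₀ Ψ₁ s).derivation R Λ A))) := by
    intro Λ A
    have hsC : Tendsto (fun k => ((sk k : ℝ) : ℂ)) atTop (𝓝 ((s : ℝ) : ℂ)) :=
      (Complex.continuous_ofReal.tendsto s).comp hs
    simp_rw [FermionInteraction.derivation_pencil, Matrix.mul_add, Matrix.mul_smul, map_add, map_smul, smul_eq_mul]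
    exact (hlim _ _).add (hsC.mul (hlim _ _))
  refine IsDKMSState.of_tangent (fun Λ A => ?_) (fun Λ A θ => ?_)
  · have h := (Complex.continuous_re.tendsto _).comp (hconv Λ A)
    rw [show ((fun z : ℂ => z.re) ∘ fun k => (ωk k).expect (thicken Λ R)
        ((fermionEmbed (PolySite.incl (subset_thicken Λ R)) A)ᴴ *
          (FermionInteraction.pencil Ψ₀ Ψ₁ (sk k)).derivation R Λ A)) = fun _ => (0 : ℝ) from
      funext fun k => (hk k).re_expect_conjTranspose_mul_derivation Λ A] at h
    exact tendsto_nhds_unique h tendsto_const_nhds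
  · have hu := (Complex.continuous_re.tendsto _).comp (hlim Λ (Aᴴ * A))
    have hv := (Complex.continuous_re.tendsto _).comp (hlim Λ (A * Aᴴ))
    have hc := (Complex.continuous_re.tendsto _).comp ((hconv Λ A).const_mul (-Complex.I))
    exact le_of_tendsto_of_tendsto' ((hu.const_mul θ).sub (hv.const_mul (Real.exp (θ - 1)))) (hβ.mul hc)
      fun k => (hk k).tangent_le Λ A θ

end InfVolFermionState

/-- **Without source the pair-sourced `t–t'` interaction IS the grand-canonical `t–t'` Hubbard interaction** (zero Zeeman
field): `Φ(t,t',U) − μn − 0·P_g = gcInteractionTT' t t' U μ 0` (termwise). [cite: KomaTasaki1994, §1] -/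
theorem hubbardTTPrimeSourcedInteraction_zero_eq_gcInteractionTT' (t t' U μ : ℝ) (g : Site 2 → ℝ) :
    hubbardTTPrimeSourcedInteraction t t' U μ g 0 = gcInteractionTT' t t' U μ 0 := by
  refine FermionInteraction.ext fun X => ?_
  rw [hubbardTTPrimeSourcedInteraction_apply, hubbardTTPrimeMuInteraction_apply, gcInteractionTT',
    FermionInteraction.linearFamily_apply, Fin.sum_univ_two]
  simp only [Matrix.cons_val_zero, Matrix.cons_val_one, neg_zero, Complex.ofReal_zero, zero_smul, add_zero]

namespace InfVolFermionState

/-- **Limits of equilibrium states of the pair-sourced `t–t'` Hubbard model along `h_k → h` are equilibrium states at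
source `h`** (any real `β_k → β`, any range parameter `R`). [cite: BratteliRobinsonII1997, Prop. 5.3.25 and Thm. 5.3.30]
[cite: ArakiMoriya2003, Def 6.3] -/
theorem IsDKMSState.hubbardTTPrimeSourced_of_tendsto {t t' U μ : ℝ} {g : Site 2 → ℝ} {R : ℝ}
    {ωk : ℕ → InfVolFermionState 2} {hk βk : ℕ → ℝ} {h β : ℝ} {ω : InfVolFermionState 2}
    (hdk : ∀ k, (ωk k).IsDKMSState (hubbardTTPrimeSourcedInteraction t t' U μ g (hk k)) R (βk k))
    (hh : Tendsto hk atTop (𝓝 h)) (hβ : Tendsto βk atTop (𝓝 β))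
    (hlim : ∀ (Λ : Finset (Site 2)) (A : FermionOp Λ), Tendsto (fun k => (ωk k).expect Λ A) atTop (𝓝 (ω.expect Λ A))) :
    ω.IsDKMSState (hubbardTTPrimeSourcedInteraction t t' U μ g h) R β :=
  IsDKMSState.of_tendsto_pencil (Ψ₀ := hubbardTTPrimeMuInteraction t t' U μ) (Ψ₁ := pairSourceInteraction g)
    (sk := fun k => -hk k) hdk hh.neg hβ hlim

/-- **ZERO-SOURCE LIMITS OF EQUILIBRIUM STATES OF THE PAIR-SOURCED MODEL ARE EQUILIBRIUM STATES OF THE `t–t'` HUBBARD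
MODEL**: if `ω_k` is a dKMS state of `Φ(t,t',U) − μn − h_kP_g` at `β_k`, `h_k → 0`, `β_k → β`, and `ω_k → ω` on every local
algebra, then `ω` is a dKMS state at `β` of the grand-canonical `t–t'` Hubbard interaction `gcInteractionTT' t t' U μ 0` — the
`T > 0` states «obtained by applying an infinitesimal symmetry-breaking field» (Koma–Tasaki 1993 (1.8)) are genuine
equilibrium states of the unperturbed model. [cite: KomaTasaki1993, §1 (1.8)] [cite: BratteliRobinsonII1997, Prop. 5.3.25]
[cite: ArakiMoriya2003, Def 6.3, Thm. 6.4] -/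
theorem IsDKMSState.gcInteractionTT'_of_tendsto_source {t t' U μ : ℝ} {g : Site 2 → ℝ} {R : ℝ}
    {ωk : ℕ → InfVolFermionState 2} {hk βk : ℕ → ℝ} {β : ℝ} {ω : InfVolFermionState 2}
    (hdk : ∀ k, (ωk k).IsDKMSState (hubbardTTPrimeSourcedInteraction t t' U μ g (hk k)) R (βk k))
    (hh : Tendsto hk atTop (𝓝 0)) (hβ : Tendsto βk atTop (𝓝 β))
    (hlim : ∀ (Λ : Finset (Site 2)) (A : FermionOp Λ), Tendsto (fun k => (ωk k).expect Λ A) atTop (𝓝 (ω.expect Λ A))) :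
    ω.IsDKMSState (gcInteractionTT' t t' U μ 0) R β := by
  rw [← hubbardTTPrimeSourcedInteraction_zero_eq_gcInteractionTT' t t' U μ g]
  exact IsDKMSState.hubbardTTPrimeSourced_of_tendsto hdk hh hβ hlim

end InfVolFermionState

/-! ### §5 Zero-temperature limits along a pencil: `β_k → ∞`, `h_k → h` limits of sourced equilibrium states are ground states -/

namespace InfVolFermionState

variable {d : ℕ}

/-- The generator term is jointly continuous along a pencil: `ω_k(Ãᴴ δ_{s_k}A) → ω(Ãᴴ δ_sA)` when `s_k → s` and `ω_k → ω`
pointwise (`δ_s = δ_{Ψ₀} + s δ_{Ψ₁}`). [cite: BratteliRobinsonII1997, Prop. 5.3.25] -/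
theorem tendsto_expect_conjTranspose_mul_derivation_pencil {Ψ₀ Ψ₁ : FermionInteraction d} {R : ℝ}
    {ωk : ℕ → InfVolFermionState d} {sk : ℕ → ℝ} {s : ℝ} {ω : InfVolFermionState d} (hs : Tendsto sk atTop (𝓝 s))
    (hlim : ∀ (Λ : Finset (Site d)) (A : FermionOp Λ), Tendsto (fun k => (ωk k).expect Λ A) atTop (𝓝 (ω.expect Λ A)))
    (Λ : Finset (Site d)) (A : FermionOp Λ) :
    Tendsto (fun k => (ωk k).expect (thicken Λ R)
      ((fermionEmbed (PolySite.incl (subset_thicken Λ R)) A)ᴴ *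
        (FermionInteraction.pencil Ψ₀ Ψ₁ (sk k)).derivation R Λ A))
      atTop (𝓝 (ω.expect (thicken Λ R)
        ((fermionEmbed (PolySite.incl (subset_thicken Λ R)) A)ᴴ *
          (FermionInteraction.pencil Ψ₀ Ψ₁ s).derivation R Λ A))) := by
  have hsC : Tendsto (fun k => ((sk k : ℝ) : ℂ)) atTop (𝓝 ((s : ℝ) : ℂ)) :=
    (Complex.continuous_ofReal.tendsto s).comp hs
  simp_rw [FermionInteraction.derivation_pencil, Matrix.mul_add, Matrix.mul_smul, map_add, map_smul, smul_eq_mul]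
  exact (hlim _ _).add (hsC.mul (hlim _ _))

/-- **ZERO-TEMPERATURE LIMITS ALONG A PENCIL ARE GROUND STATES** (Bratteli–Kishimoto–Robinson 1978 §I, joint form): if `ω_k` is a
dKMS state of `Ψ₀ + s_kΨ₁` at `β_k` with `β_k → +∞`, `s_k → s`, and `ω_k → ω` on every local algebra, then `ω` is an infinite-volume
ground state of `Ψ₀ + sΨ₁` (`InfVolFermionState.IsGroundState`).  `(C-1)` passes to the limit; the tangent row at `θ = 0`,
`−e^{−1} Re ω_k(AAᴴ) ≤ β_k Re(−iω_k(Ãᴴ δ_{s_k}A))`, gives `Re(−iω_k(Ãᴴ δ_{s_k}A)) ≥ −e^{−1}‖AAᴴ‖/β_k → 0`.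
[cite: BratteliKishimotoRobinson1978, §I (p. 41)] [cite: BratteliRobinsonII1997, Prop. 5.3.25, Def. 5.3.18] -/
theorem IsGroundState.of_isDKMSState_pencil_tendsto_atTop {Ψ₀ Ψ₁ : FermionInteraction d} {R : ℝ}
    {ωk : ℕ → InfVolFermionState d} {sk βk : ℕ → ℝ} {s : ℝ} {ω : InfVolFermionState d}
    (hk : ∀ k, (ωk k).IsDKMSState (FermionInteraction.pencil Ψ₀ Ψ₁ (sk k)) R (βk k))
    (hs : Tendsto sk atTop (𝓝 s)) (hβ : Tendsto βk atTop atTop)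
    (hlim : ∀ (Λ : Finset (Site d)) (A : FermionOp Λ), Tendsto (fun k => (ωk k).expect Λ A) atTop (𝓝 (ω.expect Λ A))) :
    ω.IsGroundState (FermionInteraction.pencil Ψ₀ Ψ₁ s) R := by
  intro Λ A
  set X : ℕ → FermionOp (thicken Λ R) := fun k => (fermionEmbed (PolySite.incl (subset_thicken Λ R)) A)ᴴ *
    (FermionInteraction.pencil Ψ₀ Ψ₁ (sk k)).derivation R Λ A with hX
  set Xl : FermionOp (thicken Λ R) := (fermionEmbed (PolySite.incl (subset_thicken Λ R)) A)ᴴ *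
    (FermionInteraction.pencil Ψ₀ Ψ₁ s).derivation R Λ A with hXl
  have hconv : Tendsto (fun k => (ωk k).expect (thicken Λ R) (X k)) atTop (𝓝 (ω.expect (thicken Λ R) Xl)) :=
    tendsto_expect_conjTranspose_mul_derivation_pencil hs hlim Λ A
  have hre : (ω.expect (thicken Λ R) Xl).re = 0 := by
    have h := (Complex.continuous_re.tendsto _).comp hconv
    rw [show ((fun z : ℂ => z.re) ∘ fun k => (ωk k).expect (thicken Λ R) (X k)) = fun _ => (0 : ℝ) from
      funext fun k => (hk k).re_expect_conjTranspose_mul_derivation Λ A] at h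
    exact tendsto_nhds_unique h tendsto_const_nhds
  have hc : Tendsto (fun k => (-Complex.I * (ωk k).expect (thicken Λ R) (X k)).re) atTop
      (𝓝 (-Complex.I * ω.expect (thicken Λ R) Xl).re) :=
    (Complex.continuous_re.tendsto _).comp (hconv.const_mul (-Complex.I))
  have hlow : Tendsto (fun k => -(Real.exp (-1) * ‖A * Aᴴ‖) * (βk k)⁻¹) atTop (𝓝 0) := by
    simpa using (tendsto_inv_atTop_zero.comp hβ).const_mul (-(Real.exp (-1) * ‖A * Aᴴ‖))
  have hev : ∀ᶠ k in atTop, -(Real.exp (-1) * ‖A * Aᴴ‖) * (βk k)⁻¹ ≤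
      (-Complex.I * (ωk k).expect (thicken Λ R) (X k)).re := by
    filter_upwards [hβ.eventually_gt_atTop 0] with k hkpos
    have hrow : -(Real.exp (-1) * ((ωk k).expect Λ (A * Aᴴ)).re) ≤
        βk k * (-Complex.I * (ωk k).expect (thicken Λ R) (X k)).re := by
      have h0 := (hk k).tangent_le Λ A 0
      rw [zero_mul, zero_sub, zero_sub] at h0
      exact h0
    have hv := (ωk k).re_expect_mul_conjTranspose_self_le_norm' Λ A
    rw [← div_eq_mul_inv, div_le_iff₀ hkpos]
    have he : 0 < Real.exp (-1) := Real.exp_pos _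
    nlinarith [mul_le_mul_of_nonneg_left hv he.le]
  have hc0 : 0 ≤ (-Complex.I * ω.expect (thicken Λ R) Xl).re := le_of_tendsto_of_tendsto hlow hc hev
  refine Complex.nonneg_iff.2 ⟨hc0, ?_⟩
  simp [Complex.mul_im, hre]

/-- **`β_k → ∞`, `h_k → h` LIMITS OF EQUILIBRIUM STATES OF THE PAIR-SOURCED `t–t'` HUBBARD MODEL ARE GROUND STATES AT SOURCE
`h`** (any range parameter `R`). [cite: BratteliKishimotoRobinson1978, §I (p. 41)] [cite: KomaTasaki1993, §1 (ground states as
`β ↑ ∞` after `Λ ↑ ∞`)] -/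
theorem IsGroundState.hubbardTTPrimeSourced_of_isDKMSState_tendsto_atTop {t t' U μ : ℝ} {g : Site 2 → ℝ} {R : ℝ}
    {ωk : ℕ → InfVolFermionState 2} {hk βk : ℕ → ℝ} {h : ℝ} {ω : InfVolFermionState 2}
    (hdk : ∀ k, (ωk k).IsDKMSState (hubbardTTPrimeSourcedInteraction t t' U μ g (hk k)) R (βk k))
    (hh : Tendsto hk atTop (𝓝 h)) (hβ : Tendsto βk atTop atTop)
    (hlim : ∀ (Λ : Finset (Site 2)) (A : FermionOp Λ), Tendsto (fun k => (ωk k).expect Λ A) atTop (𝓝 (ω.expect Λ A))) :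
    ω.IsGroundState (hubbardTTPrimeSourcedInteraction t t' U μ g h) R :=
  IsGroundState.of_isDKMSState_pencil_tendsto_atTop (Ψ₀ := hubbardTTPrimeMuInteraction t t' U μ)
    (Ψ₁ := pairSourceInteraction g) (sk := fun k => -hk k) hdk hh.neg hβ hlim

/-- **ZERO-TEMPERATURE, ZERO-SOURCE LIMITS ARE GROUND STATES OF THE `t–t'` HUBBARD MODEL**: if `ω_k` are dKMS states of the
pair-sourced interactions at `(β_k, h_k)` with `β_k → ∞`, `h_k → 0`, and `ω_k → ω` on every local algebra, then `ω` is an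
infinite-volume ground state of `gcInteractionTT' t t' U μ 0` — Koma–Tasaki's ground states «obtained by letting `β → ∞` after
the infinite volume limit» along any joint schedule of source and temperature (diagonal or iterated limits alike, by a further
diagonal extraction). [cite: KomaTasaki1993, §1 (the `β ↑ ∞` ground states, Remark 3)] [cite: BratteliKishimotoRobinson1978, §I (p. 41)]
[cite: KomaTasaki1994, §1 (1.8)] -/
theorem IsGroundState.gcInteractionTT'_of_isDKMSState_tendsto_source_atTop {t t' U μ : ℝ} {g : Site 2 → ℝ} {R : ℝ}
    {ωk : ℕ → InfVolFermionState 2} {hk βk : ℕ → ℝ} {ω : InfVolFermionState 2}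
    (hdk : ∀ k, (ωk k).IsDKMSState (hubbardTTPrimeSourcedInteraction t t' U μ g (hk k)) R (βk k))
    (hh : Tendsto hk atTop (𝓝 0)) (hβ : Tendsto βk atTop atTop)
    (hlim : ∀ (Λ : Finset (Site 2)) (A : FermionOp Λ), Tendsto (fun k => (ωk k).expect Λ A) atTop (𝓝 (ω.expect Λ A))) :
    ω.IsGroundState (gcInteractionTT' t t' U μ 0) R := by
  rw [← hubbardTTPrimeSourcedInteraction_zero_eq_gcInteractionTT' t t' U μ g]
  exact IsGroundState.hubbardTTPrimeSourced_of_isDKMSState_tendsto_atTop hdk hh hβ hlim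

end InfVolFermionState

end Literature.MathematicalPhysics.QuantumLattice

end
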